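import Literature.Analysis.FluidPDE.LerayHopfUniformEnergy
import Literature.Analysis.FluidPDE.TimeAverageMeasureBasic
import HarnessLib

/-!
# Time-average measures of Leray–Hopf trajectories: the carrying ball and signed observables

Analysis/FluidPDE support file for the discharge of
`Literature.Analysis.FluidPDE.timeAverage_isStationary` (Foias–Manley–Rosa–Temam 2001, Ch. IV
Thm. 3.1). Two pieces of glue shared by the proofs of (1.30) and (1.31):

* `energyCutoff_props` — the continuous cutoff `θ_R(x) = max(0, min(1, R + 1 - x))` (`= 1` on
  `(-∞, R]`, `= 0` on `[R + 1, ∞)`, values in `[0, 1]`), used to turn norm-continuous observables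
  of polynomial growth into bounded ones without changing them on the carrying ball;
* `IsGlobalLerayHopf.exists_forall_lift_mem_closedBall` — the lifted trajectory stays in a
  closed ball `B ⊆ H` (FMRT 2001, Ch. IV (3.2): `u(t) ∈ K`), from the uniform `L²` bound
  `IsGlobalLerayHopf.exists_forall_integral_norm_sq_le` (`LerayHopfUniformEnergy`); hence every
  time-average measure is carried by `B` (`IsTimeAverageMeasure.measure_compl_eq_zero`);
* `IsTimeAverageMeasure.integral_nonpos_of_ae_timeMean_le` — **signed observables**: if a
  bounded continuous `Θ` is majorised along the trajectory, for a.e. `t > 0`, by an integrable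
  `k` whose time means are eventually `≤ B(T) → 0`, then `∫ Θ dμ ≤ 0` (positivity of `Lim`
  applied to `Θ + sup|Θ| ≥ 0`, so that no measurability of `t ↦ Θ(U t)` is needed; FMRT 2001,
  App. B.2, the passage (B.40) → `∫ … dμ ≥ -c`, PDF p. 262).

## References

* C. Foias, O. Manley, R. Rosa, R. Temam, *Navier–Stokes Equations and Turbulence*, Cambridge
  Univ. Press (2001), Ch. IV §3.1 (3.2), Cor. 3.1 (PDF pp. 208–209); App. B.2 (B.37)–(B.40)
  (PDF pp. 261–262). [FMRT2001]
-/

noncomputable section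

open MeasureTheory Set Filter Topology UnitAddTorus
open scoped InnerProductSpace RealInnerProductSpace ENNReal NNReal

namespace Literature.Analysis.FluidPDE.Torus

variable {d : Type*} [Fintype d] [DecidableEq d]

/-- Local notation for the real Hilbert space `L²(T^d; ℝ^d)`. -/
local notation "L2T " d':max => Lp (EuclideanSpace ℝ d') 2 (volume : Measure (UnitAddTorus d'))

/-- Local notation for real vector fields `T^d → ℝ^d`. -/
local notation "Vec " d':max => UnitAddTorus d' → EuclideanSpace ℝ d'

/-! ### A continuous cutoff in the energy -/

omit [Fintype d] [DecidableEq d] in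
/-- A continuous cutoff in the energy: `θ_R(x) = max(0, min(1, R + 1 - x))` is `1` on `(-∞, R]`,
`0` on `[R + 1, ∞)` and takes values in `[0, 1]`. [folklore] -/
theorem energyCutoff_props (R : ℝ) :
    Continuous (fun x : ℝ => max 0 (min 1 (R + 1 - x))) ∧
      (∀ x, x ≤ R → max 0 (min 1 (R + 1 - x)) = 1) ∧
      (∀ x, R + 1 ≤ x → max 0 (min 1 (R + 1 - x)) = 0) ∧
      (∀ x, 0 ≤ max 0 (min 1 (R + 1 - x)) ∧ max 0 (min 1 (R + 1 - x)) ≤ 1) := by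
  refine ⟨continuous_const.max (continuous_const.min (continuous_const.sub continuous_id)),
    fun x hx => ?_, fun x hx => ?_, fun x => ⟨le_max_left _ _, ?_⟩⟩
  · rw [min_eq_left (by linarith), max_eq_right zero_le_one]
  · rw [max_eq_left]
    exact min_le_of_right_le (by linarith)
  · exact max_le zero_le_one (min_le_left _ _)

/-! ### The carrying ball -/

section Ball

variable {ν : ℝ} {F u₀ : Vec d} {u : ℝ → Vec d} {U : ℝ → FunctionSpaces.Torus.energySpace d}

/-- The lifted trajectory of a global Leray–Hopf solution with steady `L²` force stays in a
closed ball of `H` for all `t ≥ 0` (FMRT 2001, Ch. IV (3.2): `u(t) ∈ K`), from the uniform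
`L²` bound `IsGlobalLerayHopf.exists_forall_integral_norm_sq_le`. [cite: FMRT2001, Ch. IV §3.1 (3.2)] -/
theorem IsGlobalLerayHopf.exists_forall_lift_mem_closedBall (hν : 0 < ν) (hF : MemLp F 2 volume)
    (hu : IsGlobalLerayHopf ν (fun _ => F) u₀ u)
    (hU : ∀ t, 0 ≤ t → ((U t : L2T d) : Vec d) =ᵐ[volume] u t) :
    ∃ R : ℝ, 0 ≤ R ∧ ∀ t, 0 ≤ t → ‖U t‖ ^ 2 ≤ R ∧
      U t ∈ Metric.closedBall (0 : FunctionSpaces.Torus.energySpace d) (Real.sqrt R) := by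
  obtain ⟨R, hR⟩ := hu.exists_forall_integral_norm_sq_le hν hF hU
  have hR0 : 0 ≤ R := (integral_nonneg fun x => sq_nonneg _).trans (hR 0 le_rfl)
  refine ⟨R, hR0, fun t ht => ?_⟩
  have hsq : ‖U t‖ ^ 2 ≤ R := by
    rw [Submodule.coe_norm, ← integral_norm_sq_eq_norm_lift_sq hU ht]
    exact hR t ht
  refine ⟨hsq, ?_⟩
  rw [mem_closedBall_zero_iff]
  exact Real.le_sqrt_of_sq_le hsq

/-- Points of the carrying ball have energy at most `R`. [folklore] -/
theorem norm_sq_le_of_mem_closedBall_sqrt {R : ℝ} (hR0 : 0 ≤ R) {v : FunctionSpaces.Torus.energySpace d}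
    (hv : v ∈ Metric.closedBall (0 : FunctionSpaces.Torus.energySpace d) (Real.sqrt R)) : ‖v‖ ^ 2 ≤ R := by
  rw [mem_closedBall_zero_iff] at hv
  calc ‖v‖ ^ 2 ≤ Real.sqrt R ^ 2 := pow_le_pow_left₀ (norm_nonneg _) hv 2
    _ = R := Real.sq_sqrt hR0

end Ball

/-! ### Signed observables majorised along the trajectory -/

section Signed

variable {Λ : GeneralizedLimit} {U : ℝ → FunctionSpaces.Torus.energySpace d}
  {μ : Measure (FunctionSpaces.Torus.energySpace d)}

/-- **Signed observables majorised along the trajectory have nonpositive mean.** Let `Θ` be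
continuous with `|Θ| ≤ C₀`, and let `k` satisfy `Θ(U t) ≤ k t` for a.e. `t > 0`, be integrable on
every `(0, T]`, and have time means eventually `≤ B(T)` with `B(T) → 0`. Then `∫ Θ dμ ≤ 0` for
every time-average measure `μ` (positivity of `Lim` applied to `Θ + C₀ ≥ 0`; FMRT 2001, App. B.2,
the passage from (B.40) to `∫ … dμ ≥ -c₃(1+λ_m)λ_k^{-1/2}`, p. 262). [cite: FMRT2001, App. B.2 (B.37)–(B.40)] -/
theorem IsTimeAverageMeasure.integral_nonpos_of_ae_timeMean_le
    (hμ : IsTimeAverageMeasure Λ.longTimeAvg U μ)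
    {Θ : FunctionSpaces.Torus.energySpace d → ℝ} (hΘ : Continuous Θ) {C₀ : ℝ} (hC₀ : ∀ v, |Θ v| ≤ C₀)
    {k : ℝ → ℝ} (hk : ∀ᵐ t ∂volume, 0 < t → Θ (U t) ≤ k t)
    (hki : ∀ T, 0 < T → IntegrableOn k (Ioc 0 T)) {B : ℝ → ℝ} (hB : ∀ᶠ T in atTop, timeMean k T ≤ B T)
    (hBlim : Tendsto B atTop (𝓝 0)) : ∫ v, Θ v ∂μ ≤ 0 := by
  haveI := hμ.1
  have hC₀0 : 0 ≤ C₀ := (abs_nonneg _).trans (hC₀ (U 0))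
  -- the shifted nonnegative observable
  set Θ' : FunctionSpaces.Torus.energySpace d → ℝ := fun v => Θ v + C₀ with hΘ'
  have hΘ'c : Continuous Θ' := hΘ.add continuous_const
  have hΘ'0 : ∀ v, 0 ≤ Θ' v := fun v => by
    have := (abs_le.1 (hC₀ v)).1
    simp only [hΘ']
    linarith
  have hΘ'b : ∀ v, |Θ' v| ≤ 2 * C₀ := fun v => by
    rw [abs_of_nonneg (hΘ'0 v)]
    have := (abs_le.1 (hC₀ v)).2
    simp only [hΘ']
    linarith
  have hΘi : Integrable Θ μ :=
    Integrable.of_bound hΘ.aestronglyMeasurable C₀ (ae_of_all _ fun v => by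
      rw [Real.norm_eq_abs]; exact hC₀ v)
  have hshift : ∫ v, Θ' v ∂μ = (∫ v, Θ v ∂μ) + C₀ := by
    simp only [hΘ']
    rw [integral_add hΘi (integrable_const C₀), integral_const, smul_eq_mul, probReal_univ,
      one_mul]
  -- its time means are dominated by those of `k + C₀`
  have hmean : ∀ᶠ T in atTop, timeMean (fun t => Θ' (U t)) T ≤ B T + C₀ := by
    filter_upwards [hB, eventually_gt_atTop 0] with T hTB hT
    have hkC : IntegrableOn (fun t => k t + C₀) (Ioc 0 T) := by
      haveI : IsFiniteMeasure (volume.restrict (Ioc (0 : ℝ) T)) :=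
        ⟨by rw [Measure.restrict_apply_univ]; exact measure_Ioc_lt_top⟩
      exact (hki T hT).add (integrable_const C₀)
    have h1 : timeMean (fun t => Θ' (U t)) T ≤ timeMean (fun t => k t + C₀) T := by
      unfold timeMean
      rw [intervalIntegral.integral_of_le hT.le, intervalIntegral.integral_of_le hT.le]
      refine mul_le_mul_of_nonneg_left ?_ (inv_nonneg.2 hT.le)
      refine integral_mono_of_nonneg (ae_of_all _ fun t => hΘ'0 _) hkC ?_
      filter_upwards [ae_restrict_mem measurableSet_Ioc, ae_restrict_of_ae hk] with t ht hkt
      simp only [hΘ']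
      linarith [hkt ht.1]
    have h2 : timeMean (fun t => k t + C₀) T = timeMean k T + C₀ := by
      unfold timeMean
      rw [intervalIntegral.integral_of_le hT.le, intervalIntegral.integral_of_le hT.le,
        integral_add (hki T hT) ?_, setIntegral_const, Real.volume_real_Ioc_of_le hT.le, sub_zero,
        smul_eq_mul, mul_add, ← mul_assoc, inv_mul_cancel₀ hT.ne', one_mul]
      haveI : IsFiniteMeasure (volume.restrict (Ioc (0 : ℝ) T)) :=
        ⟨by rw [Measure.restrict_apply_univ]; exact measure_Ioc_lt_top⟩
      exact integrable_const C₀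
    linarith
  -- positivity / monotonicity of the generalized limit
  have hId : ∫ v, Θ' v ∂μ = Λ (timeMean fun t => Θ' (U t)) := hμ.integral_eq hΘ'c hΘ'b
  have hle : Λ (timeMean fun t => Θ' (U t)) ≤ Λ (fun T => B T + C₀) := by
    refine Λ.apply_mono (isBoundedUnder_ge_timeMean fun t _ => hΘ'b _) ?_ hmean
    exact (hBlim.add tendsto_const_nhds).isBoundedUnder_le
  have hlimv : Λ (fun T => B T + C₀) = C₀ := by
    refine Λ.apply_eq_of_tendsto ?_
    simpa using hBlim.add tendsto_const_nhds
  have : (∫ v, Θ v ∂μ) + C₀ ≤ C₀ := by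
    rw [← hshift, hId]
    exact hle.trans_eq hlimv
  linarith

end Signed

end Literature.Analysis.FluidPDE.Torus
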